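import Summits.RiemannHypothesis.RiemannHypothesis.Theorems.EarlyAppointmentsRemainder0XiFarFieldReindex
import Summits.RiemannHypothesis.RiemannHypothesis.Theorems.EarlyAppointmentsRemainder0XiFarLogKernelBasics
import Summits.RiemannHypothesis.RiemannHypothesis.Theorems.EarlyAppointmentsRemainder0XiRho2V4Objects

/-!
# ⟨24730⟩ ρ2 v4 — (CA403)(iii)/(CA406)(c) the ABEL-SUMMATION SKELETON of `FarAbel4`: the stub from four NAMED LEAVES

C4 «kernel desk» rh-idea-6 g30, director (CA403)(iii)/(CA404)/(CA406).  SUPPORT module for crux r3 `Remainder0Xi`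
(stmt-RiemannHypothesis-24730), line `Cruxes/Remainder0Xi/Lines/rho2_v4.lean`, stub `stub_farAbel4 : FarAbel4`
(budget `errorBudget4 = 3/10` s-shares ≈ 1.28 absolute at `T_PT`).
FULLY PROVED COMPOSITION (no `sorry`): `FarAbel4` BY NAME (Theorems-side mirror `…Rho2V4.FarAbel4` of
…Rho2V4Objects, body = registry verbatim, over `Rho2V4.farField`, `mainIntegral` (#1042), `T_PT`, `boxHalfWidth`,
`eta0`, `xiSpacing` (…EtaLedgerArith), `Rho2V4.errorBudget4`) follows from four LEAVES stated over a free table of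
constants `K : LeafConsts` — three ANALYTIC leaves with explicit-constant shape and ONE closed real inequality:

* `KernelShiftLeaf K`  — replacing each far zero `ρ` by its height `Re ρ` and the point `w` by `Re w` in the pair
  kernel costs `≤ K.cS · log(γ/2π)` (eventually in the truncation height `T`, up to any `ε > 0`):
  `‖F_T(w) − G_T(Re w)‖ ≤ K.cS·L + ε`, `L = log(γ/2π)`.  Source of the constant: `|∂_w 2w/(w²−ρ²)| ≤ 2/(|Re ρ − Re w| − 1)²`
  on the far range (`|Im w| ≤ ½`, `|Im ρ| < ½`: tree `abs_im_lt_half_of_riemannXiUpper_eq_zero`), summed against the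
  zero count (`Literature…ZetaArgHSW.hsw_bounds` / `zetaZeroCount_hasanalizade_shen_wong_holds`): two shifts of size
  `≲ (1/2)·(L/2π)·(2/66.5)` each — the registry's shares `e1 = e2 = 0.0148`.
* `AbelMainLeaf K`     — Abel summation of the HEIGHT sum against `N(t)` (`Literature…SchoenfeldZeroSums.sum_zerosBetween_eq`,
  counted through `sum_analyticOrderNatAt_eq_zetaZeroCount`) and comparison with the smooth density `(1/2π) log(t/2π)`:
  `|G_T(x) − MAIN(x)| ≤ K.a·L + K.b + ε` eventually in `T`; constants from the HSW remainder
  `|N(t) − (t/2π)log(t/2πe) − 7/8| ≤ 0.1038 log t + 0.2573 log log t + 9.3675`, the kernel-derivative integrals of tree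
  `…Remainder0XiFarKernelTailBound` / `…FarKernelWindowBounds` / `…TruncationHelper`, and `N(lowStart) = N(14) = 0`
  — the registry's shares `e3 = 0.0602`, `e4 = 0.0015`.
* `NearPartnerLeaf K`  — the finitely many partner terms of the near zeros: `‖∑_{|Re u − Re w| < 135/2} ord_u·(w + u)⁻¹‖ ≤ K.cN`
  (each term `≤ 1/(2γ − 135)`, at most `N(γ + 68) − N(γ − 68)` terms) — the registry's share `e5 = 0.00003`.
* `LedgerLeaf4 K`      — the CLOSED REAL INEQUALITY `(K.cS + K.a)·L + K.b + K.cN ≤ errorBudget4 / xiSpacing γ`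
  for `γ > T_PT` (`errorBudget4 / xiSpacing γ = 0.3 · L/(2π)`, `L ≥ 26.9`): the numeric leaf for C3 (director's
  crude sizing with HSW Cor 1.2 sup bounds at both edges: total ≈ 0.93 abs ≤ 1.28 — margin 27 %, no S₁ refinement).

★ `farAbel4_of_leaves (K) : KernelShiftLeaf K → AbelMainLeaf K → NearPartnerLeaf K → LedgerLeaf4 K → FarAbel4`
(and `farAbel4_text_of_leaves`, the registry text spelled verbatim).  The convergence input
`…FarFieldReindex.farField_tendsto_of_box` is stated over the v2-named mirror `Rho2V2.farField`; `Rho2V4.farField`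
has the same body (`rfl`).
Proof: `F_T(w) + P(w) − MAIN(Re w) ⟶ FAR(w) − MAIN(Re w)` (…FarFieldReindex `farField_tendsto_of_box`), the three
analytic leaves bound the left side eventually by `budget + ε`, `le_of_tendsto`, `ε ↓ 0`.
No leaf is asserted here; the constants are free, so nothing in this file can be false — a table `K` validating the
four leaves closes `stub_farAbel` by ONE application.  Helper namespace only (nothing declared in `…Rho2V2`).
Nothing here bears on the truth of RH; RH is not proved; 24730 OPEN.
-/

noncomputable section

set_option linter.dupNamespace false

open Literature.NumberTheory.LFunctions

namespace Summit.RiemannHypothesis.RiemannHypothesis.Theorems.EarlyAppointmentsRemainder0Xi.FarAbelSkeleton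

open Complex Filter Topology Set
open Summit.RiemannHypothesis.RiemannHypothesis.Cruxes.Remainder0Xi.Rho2V2
  (T_PT boxHalfWidth eta0 xiSpacing mainIntegral)
open Summit.RiemannHypothesis.RiemannHypothesis.Cruxes.Remainder0Xi.Rho2V4 (farField errorBudget4 FarAbel4)
open Summit.RiemannHypothesis.RiemannHypothesis.Theorems.EarlyAppointmentsRemainder0Xi.FarFieldReindex
  (farField_tendsto_of_box)

/-! ## §1 The objects of the Abel step -/

/-- The far part of the one-sided zero box at the real point `x`, truncated at height `T`. -/
def farBoxAt (x T : ℝ) : Set ℂ :=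
  {ρ : ℂ | riemannXiUpper ρ = 0 ∧ 0 < ρ.re ∧ ρ.re ≤ T ∧ boxHalfWidth ≤ |ρ.re - x|}

/-- `F_T(w)`: the far Hadamard PAIR sum (the summand of …FarFieldReindex `farField_tendsto`). -/
def farPairSum (w : ℂ) (T : ℝ) : ℂ :=
  ∑ᶠ ρ ∈ farBoxAt w.re T, ((analyticOrderAt riemannXiUpper ρ).toNat : ℂ) * 2 * w / (w ^ 2 - ρ ^ 2)

/-- `G_T(x)`: the far HEIGHT sum — every far zero replaced by its height `Re ρ`, kernel at the real point `x`. -/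
def farHeightSum (x T : ℝ) : ℝ :=
  ∑ᶠ ρ ∈ farBoxAt x T, ((analyticOrderAt riemannXiUpper ρ).toNat : ℝ) * (2 * x / (x ^ 2 - ρ.re ^ 2))

/-- `P(w)`: the partner terms `(w + u)⁻¹` of the near zeros (…FarFieldReindex `farField_tendsto`). -/
def nearPartnerSum (w : ℂ) : ℂ :=
  ∑ᶠ u ∈ {u : ℂ | riemannXiUpper u = 0 ∧ |u.re - w.re| < boxHalfWidth},
    ((analyticOrderAt riemannXiUpper u).toNat : ℂ) * (w + u)⁻¹

/-- The free table of leaf constants (to be instantiated by the constants desk). -/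
structure LeafConsts where
  /-- kernel shift (zeros ↦ heights, `w ↦ Re w`): coefficient of `log(γ/2π)` (registry shares `e1 + e2`). -/
  cS : ℝ
  /-- Abel/HSW comparison: coefficient of `log(γ/2π)` (part of `e3`). -/
  a : ℝ
  /-- Abel/HSW comparison: constant term (rest of `e3`, and `e4`). -/
  b : ℝ
  /-- near partner terms (`e5`). -/
  cN : ℝ

/-! ## §2 The four leaves -/

/-- LEAF 1 (analytic, shares `e1 + e2`): kernel shift. -/
def KernelShiftLeaf (K : LeafConsts) : Prop :=
  ∀ γ : ℝ, T_PT < γ → ∀ w : ℂ, |w.re - γ| ≤ boxHalfWidth → |w.im| ≤ eta0 → riemannXiUpper w ≠ 0 →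
    ∀ ε : ℝ, 0 < ε → ∀ᶠ T : ℝ in atTop,
      ‖farPairSum w T - (farHeightSum w.re T : ℂ)‖ ≤ K.cS * Real.log (γ / (2 * Real.pi)) + ε

/-- LEAF 2 (analytic, shares `e3 + e4`): Abel summation of the height sum against `N(t)` versus `MAIN(x)`. -/
def AbelMainLeaf (K : LeafConsts) : Prop :=
  ∀ γ : ℝ, T_PT < γ → ∀ x : ℝ, |x - γ| ≤ boxHalfWidth →
    ∀ ε : ℝ, 0 < ε → ∀ᶠ T : ℝ in atTop,
      |farHeightSum x T - mainIntegral x| ≤ K.a * Real.log (γ / (2 * Real.pi)) + K.b + ε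

/-- LEAF 3 (analytic, share `e5`): the near partner terms. -/
def NearPartnerLeaf (K : LeafConsts) : Prop :=
  ∀ γ : ℝ, T_PT < γ → ∀ w : ℂ, |w.re - γ| ≤ boxHalfWidth → |w.im| ≤ eta0 →
    ‖nearPartnerSum w‖ ≤ K.cN

/-- LEAF 4 (numeric, closed real inequality): the v4 ledger. -/
def LedgerLeaf4 (K : LeafConsts) : Prop :=
  ∀ γ : ℝ, T_PT < γ →
    (K.cS + K.a) * Real.log (γ / (2 * Real.pi)) + K.b + K.cN ≤ errorBudget4 / xiSpacing γ

/-! ## §3 The composition -/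

/-- ★ **`FarAbel4` from the four leaves**, registry text of `Lines/rho2_v4.lean` spelled verbatim. -/
theorem farAbel4_text_of_leaves (K : LeafConsts) (hS : KernelShiftLeaf K) (hA : AbelMainLeaf K)
    (hN : NearPartnerLeaf K) (hL : LedgerLeaf4 K) :
    ∀ γ : ℝ, T_PT < γ → ∀ w : ℂ, |w.re - γ| ≤ boxHalfWidth → |w.im| ≤ eta0 →
      riemannXiUpper w ≠ 0 →
      ‖farField w - (mainIntegral w.re : ℂ)‖ ≤ errorBudget4 / xiSpacing γ := by
  intro γ hγ w hwγ hwim hw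
  have ht : Tendsto (fun T : ℝ ↦ farPairSum w T) atTop (𝓝 (farField w - nearPartnerSum w)) :=
    farField_tendsto_of_box hγ w hwγ hw
  have ht' : Tendsto (fun T : ℝ ↦ farPairSum w T + nearPartnerSum w - (mainIntegral w.re : ℂ)) atTop
      (𝓝 (farField w - (mainIntegral w.re : ℂ))) := by
    have h := (ht.add_const (nearPartnerSum w)).sub_const (mainIntegral w.re : ℂ)
    rwa [sub_add_cancel] at h
  refine le_of_forall_pos_le_add fun ε hε ↦ ?_
  have hε2 : 0 < ε / 2 := by positivity
  have hev : ∀ᶠ T : ℝ in atTop,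
      ‖farPairSum w T + nearPartnerSum w - (mainIntegral w.re : ℂ)‖ ≤
        errorBudget4 / xiSpacing γ + ε := by
    filter_upwards [hS γ hγ w hwγ hwim hw (ε / 2) hε2, hA γ hγ w.re hwγ (ε / 2) hε2] with T h1 h2
    have h3 := hN γ hγ w hwγ hwim
    have h4 := hL γ hγ
    have hsplit : farPairSum w T + nearPartnerSum w - (mainIntegral w.re : ℂ) =
        (farPairSum w T - (farHeightSum w.re T : ℂ)) +
          ((farHeightSum w.re T - mainIntegral w.re : ℝ) : ℂ) + nearPartnerSum w := by
      push_cast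
      ring
    have h2' : ‖((farHeightSum w.re T - mainIntegral w.re : ℝ) : ℂ)‖ ≤
        K.a * Real.log (γ / (2 * Real.pi)) + K.b + ε / 2 := by
      rw [Complex.norm_real, Real.norm_eq_abs]
      exact h2
    rw [hsplit]
    calc ‖(farPairSum w T - (farHeightSum w.re T : ℂ)) +
            ((farHeightSum w.re T - mainIntegral w.re : ℝ) : ℂ) + nearPartnerSum w‖
        ≤ ‖farPairSum w T - (farHeightSum w.re T : ℂ)‖ +
            ‖((farHeightSum w.re T - mainIntegral w.re : ℝ) : ℂ)‖ + ‖nearPartnerSum w‖ :=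
          norm_add₃_le
      _ ≤ (K.cS * Real.log (γ / (2 * Real.pi)) + ε / 2) +
            (K.a * Real.log (γ / (2 * Real.pi)) + K.b + ε / 2) + K.cN := by
          gcongr
      _ = ((K.cS + K.a) * Real.log (γ / (2 * Real.pi)) + K.b + K.cN) + ε := by ring
      _ ≤ errorBudget4 / xiSpacing γ + ε := by linarith
  exact le_of_tendsto ht'.norm hev

/-- ★ **`FarAbel4` from the four leaves, BY NAME** (the v4 registry stub 1 is `stub_farAbel4 : FarAbel4`). -/
theorem farAbel4_of_leaves (K : LeafConsts) (hS : KernelShiftLeaf K) (hA : AbelMainLeaf K)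
    (hN : NearPartnerLeaf K) (hL : LedgerLeaf4 K) : FarAbel4 :=
  farAbel4_text_of_leaves K hS hA hN hL

end Summit.RiemannHypothesis.RiemannHypothesis.Theorems.EarlyAppointmentsRemainder0Xi.FarAbelSkeleton

end
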